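import Summits.CriticalPhenomena.PercolationContinuityZ3.Theorems.PercNearOneGluingNoHeavyLowerTailCILRelayNeighboursSeparation
import Literature.Probability.Percolation.HierarchicalPercolation
import HarnessLib

/-!
# `NoHeavyLowerTail` (stmt-CriticalPhenomena-4575) — CIL for EVERY observer adjacent only to relays (unconditional)

Support file (prover `prim-gen-induct`; `--supports stmt-CriticalPhenomena-4575`).  No definitions, no named facts, no sorries.

`cil_relayNeighbours` — for every finite weighted graph, every relay set `A`, every observer `o ∉ A` ALL of whose
positive-weight neighbours are relays (at least one), and every level `j`, some relay `a ∈ A` (a neighbour of `o`) has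
`μ{1 ≤ N ≤ j} ≤ μ{|π(a)| ≤ j}` — the registered stub `stub_cumulativeIsolation` (crux `NoHeavyLowerTail`) on this class, for
every `|A|` and with NO assumption on the graph away from `o`.  Witness: the port `p i` maximising `μ{M_i ≤ j}`, `M_m` = number
of relays joined to `p m` without using an edge at `o`.

Step 3 of the chain (steps 1–2 = `…CILRelayNeighboursSeparation`): the port comparison (⋆) of
`Theorems.cil_relayNeighbours_of_portComparison` is obtained from separation stability (†) by (a) transferring (†) to the
configuration with the edges at `o` removed (`prodBernoulli_map_inter`: `ω ↦ ω ∩ {e | o ∉ e}` pushes `μ_w` forward to the product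
measure with the weights at `o` switched off) and (b) integrating the independent port coins one at a time
(`CutObserver.portComparison_of_separation`, induction on the set of coin-carrying ports).
-/

noncomputable section

namespace Summit.CriticalPhenomena.PercolationContinuityZ3.Theorems

open MeasureTheory Set Literature.Probability.LatticeModels Literature.Probability.Percolation
open scoped Classical BigOperators

variable {n : ℕ}

namespace CutObserver

/-! ### Step 3a: transfer to the configuration without the edges at `o` -/

/-- `μ_w{ω | ω ∩ {e | o ∉ e} ∈ S} = μ_u(S)` where `u` switches the weights at `o` off. [folklore] -/
theorem measureReal_preimage_avoid (w : Sym2 (Fin n) → unitInterval) (o : Fin n) (S : Set (BondConfig (Fin n))) :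
    (prodBernoulli w).real {ω : BondConfig (Fin n) | ω ∩ {e | o ∉ e} ∈ S} =
      (prodBernoulli fun e => if e ∈ {e : Sym2 (Fin n) | o ∉ e} then w e else 0).real S := by
  have hmap := prodBernoulli_map_inter w {e : Sym2 (Fin n) | o ∉ e}
  have hproj : Measurable (fun ξ : Set (Sym2 (Fin n)) => ξ ∩ {e | o ∉ e}) :=
    measurable_set_iff.2 fun i => (measurable_set_mem i).and measurable_const
  have h := Measure.map_apply (μ := prodBernoulli w) hproj (MeasurableSet.of_discrete (s := S))
  rw [hmap] at h
  simp only [measureReal_def]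
  rw [h]
  rfl

/-! ### Step 3b: integrating the port coins -/

/-- **(⋆) from (†), with coins.**  Ports `p` (injective relays, observer `o ∉ A` adjacent only to ports), `H`-reachability
`R` (no edge at `o`), `M_x` = relays `H`-joined to `p x`.  If `μ{M_l ≤ j} ≤ μ{M_i ≤ j}` then for every finite set `Q` of port
indices and every finite vertex set `S`:
`μ({∀ m ∈ Q, p m ~' p i → o–p m closed} ∩ {∀ v ∈ S, v ≁' p i} ∩ {M_l ≤ j}) ≤ μ(… ∩ {M_i ≤ j})`.
Induction on `Q`: peeling one coin gives a convex combination of the statements for `Q ∖ m₀` with `S` and `S ∪ {p m₀}`;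
the base `Q = ∅` is separation stability (†) transferred by `measureReal_preimage_avoid`. [folklore] -/
theorem portComparison_of_separation (w : Sym2 (Fin n) → unitInterval) (A : Finset (Fin n)) (o : Fin n) (j : ℕ)
    {d : ℕ} (p : Fin d → Fin n) (hp : Function.Injective p) {i l : Fin d} (hil : i ≠ l)
    (hs : (prodBernoulli w).real {ω : BondConfig (Fin n) |
        (A.filter fun x => (openGraph (ω ∩ {e | o ∉ e})).Reachable (p l) x).card ≤ j} ≤
      (prodBernoulli w).real {ω : BondConfig (Fin n) |
        (A.filter fun x => (openGraph (ω ∩ {e | o ∉ e})).Reachable (p i) x).card ≤ j})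
    (Q : Finset (Fin d)) (S : Finset (Fin n)) :
    (prodBernoulli w).real
        ({ω : BondConfig (Fin n) | ∀ m ∈ Q, (openGraph (ω ∩ {e | o ∉ e})).Reachable (p m) (p i) → s(o, p m) ∉ ω} ∩
          {ω | ∀ v ∈ S, ¬ (openGraph (ω ∩ {e | o ∉ e})).Reachable v (p i)} ∩
          {ω | (A.filter fun x => (openGraph (ω ∩ {e | o ∉ e})).Reachable (p l) x).card ≤ j}) ≤
      (prodBernoulli w).real
        ({ω : BondConfig (Fin n) | ∀ m ∈ Q, (openGraph (ω ∩ {e | o ∉ e})).Reachable (p m) (p i) → s(o, p m) ∉ ω} ∩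
          {ω | ∀ v ∈ S, ¬ (openGraph (ω ∩ {e | o ∉ e})).Reachable v (p i)} ∩
          {ω | (A.filter fun x => (openGraph (ω ∩ {e | o ∉ e})).Reachable (p i) x).card ≤ j}) := by
  haveI : IsProbabilityMeasure (prodBernoulli w) := inferInstance
  set R : BondConfig (Fin n) → Fin n → Fin n → Prop := fun ω u v =>
    (openGraph (ω ∩ {e | o ∉ e})).Reachable u v with hR
  set M : BondConfig (Fin n) → Fin d → ℕ := fun ω x => (A.filter fun y => R ω (p x) y).card with hM
  induction Q using Finset.induction_on generalizing S with
  | empty =>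
    -- base: separation stability in the graph without the edges at `o`
    set u : Sym2 (Fin n) → unitInterval := fun e => if e ∈ {e : Sym2 (Fin n) | o ∉ e} then w e else 0 with hu
    have hpil : p i ≠ p l := fun h => hil (hp h)
    have key := separation_stable u A hpil S j ?_
    · have e1 : ∀ x : Fin d,
          {ω : BondConfig (Fin n) | ∀ m ∈ (∅ : Finset (Fin d)), R ω (p m) (p i) → s(o, p m) ∉ ω} ∩
            {ω | ∀ v ∈ S, ¬ R ω v (p i)} ∩ {ω | M ω x ≤ j} =
          {ω : BondConfig (Fin n) | ω ∩ {e | o ∉ e} ∈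
            ({ξ : BondConfig (Fin n) | ∀ m ∈ S, ¬ (openGraph ξ).Reachable (p i) m} ∩
              {ξ | (A.filter fun y => (openGraph ξ).Reachable (p x) y).card ≤ j})} := by
        intro x
        ext ω
        simp only [hR, hM, Finset.notMem_empty, false_imp_iff, implies_true, setOf_true, univ_inter,
          mem_inter_iff, mem_setOf_eq]
        constructor
        · rintro ⟨h1, h2⟩; exact ⟨fun m hm hr => h1 m hm hr.symm, h2⟩
        · rintro ⟨h1, h2⟩; exact ⟨fun v hv hr => h1 v hv hr.symm, h2⟩
      rw [e1 l, e1 i, measureReal_preimage_avoid, measureReal_preimage_avoid]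
      exact key
    · have e2 : ∀ x : Fin d, {ω : BondConfig (Fin n) | M ω x ≤ j} =
          {ω : BondConfig (Fin n) | ω ∩ {e | o ∉ e} ∈
            {ξ : BondConfig (Fin n) | (A.filter fun y => (openGraph ξ).Reachable (p x) y).card ≤ j}} := by
        intro x; ext ω; simp only [hM, hR, mem_setOf_eq]
      have h := hs
      change (prodBernoulli w).real {ω | M ω l ≤ j} ≤ (prodBernoulli w).real {ω | M ω i ≤ j} at h
      rw [e2 l, e2 i, measureReal_preimage_avoid, measureReal_preimage_avoid] at h
      exact h
  | insert m₀ Q hm₀ ih =>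
    -- peel the coin of port m₀
    set c : ℝ := (w s(o, p m₀) : ℝ) with hc
    have hc0 : 0 ≤ c := (w s(o, p m₀)).2.1
    have hc1 : c ≤ 1 := (w s(o, p m₀)).2.2
    -- the decomposition, for a generic H-event F (here F = Sep S ∩ {M_x ≤ j})
    have decomp : ∀ x : Fin d, ∀ S' : Finset (Fin n),
        (prodBernoulli w).real
          ({ω : BondConfig (Fin n) | ∀ m ∈ insert m₀ Q, R ω (p m) (p i) → s(o, p m) ∉ ω} ∩
            {ω | ∀ v ∈ S', ¬ R ω v (p i)} ∩ {ω | M ω x ≤ j}) =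
        c * (prodBernoulli w).real
          ({ω : BondConfig (Fin n) | ∀ m ∈ Q, R ω (p m) (p i) → s(o, p m) ∉ ω} ∩
            {ω | ∀ v ∈ insert (p m₀) S', ¬ R ω v (p i)} ∩ {ω | M ω x ≤ j}) +
        (1 - c) * (prodBernoulli w).real
          ({ω : BondConfig (Fin n) | ∀ m ∈ Q, R ω (p m) (p i) → s(o, p m) ∉ ω} ∩
            {ω | ∀ v ∈ S', ¬ R ω v (p i)} ∩ {ω | M ω x ≤ j}) := by
      intro x S'
      set EQ := {ω : BondConfig (Fin n) | ∀ m ∈ Q, R ω (p m) (p i) → s(o, p m) ∉ ω} with hEQ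
      set F := {ω : BondConfig (Fin n) | ∀ v ∈ S', ¬ R ω v (p i)} ∩ {ω | M ω x ≤ j} with hF
      set R0 := {ω : BondConfig (Fin n) | R ω (p m₀) (p i)} with hR0
      set C0 := {ω : BondConfig (Fin n) | s(o, p m₀) ∉ ω} with hC0
      -- set identities
      have hsplit : {ω : BondConfig (Fin n) | ∀ m ∈ insert m₀ Q, R ω (p m) (p i) → s(o, p m) ∉ ω} ∩
          {ω | ∀ v ∈ S', ¬ R ω v (p i)} ∩ {ω | M ω x ≤ j} =
          (EQ ∩ F ∩ R0ᶜ) ∪ (C0 ∩ (EQ ∩ F ∩ R0)) := by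
        ext ω
        simp only [hEQ, hF, hR0, hC0, Finset.forall_mem_insert, mem_inter_iff, mem_union, mem_setOf_eq,
          mem_compl_iff]
        constructor
        · rintro ⟨⟨⟨h0, hQ⟩, hS⟩, hMx⟩
          by_cases hr : R ω (p m₀) (p i)
          · exact Or.inr ⟨h0 hr, ⟨hQ, hS, hMx⟩, hr⟩
          · exact Or.inl ⟨⟨hQ, hS, hMx⟩, hr⟩
        · rintro (⟨⟨hQ, hS, hMx⟩, hr⟩ | ⟨h0, ⟨hQ, hS, hMx⟩, hr⟩)
          · exact ⟨⟨⟨fun h => absurd h hr, hQ⟩, hS⟩, hMx⟩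
          · exact ⟨⟨⟨fun _ => h0, hQ⟩, hS⟩, hMx⟩
      have hdisj : Disjoint (EQ ∩ F ∩ R0ᶜ) (C0 ∩ (EQ ∩ F ∩ R0)) := by
        rw [Set.disjoint_left]; rintro ω ⟨_, hr⟩ ⟨_, _, hr'⟩; exact hr hr'
      have hinsert : EQ ∩ {ω : BondConfig (Fin n) | ∀ v ∈ insert (p m₀) S', ¬ R ω v (p i)} ∩ {ω | M ω x ≤ j} =
          EQ ∩ F ∩ R0ᶜ := by
        ext ω
        simp only [hEQ, hF, hR0, Finset.forall_mem_insert, mem_inter_iff, mem_setOf_eq, mem_compl_iff]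
        tauto
      have hplain : EQ ∩ {ω : BondConfig (Fin n) | ∀ v ∈ S', ¬ R ω v (p i)} ∩ {ω | M ω x ≤ j} = EQ ∩ F := by
        rw [hF, inter_assoc]
      -- independence of the coin at m₀ from EQ ∩ F ∩ R0
      set Eo : Finset (Sym2 (Fin n)) := Finset.univ.filter fun e : Sym2 (Fin n) => o ∉ e with hEo
      have hcoe : (↑Eo : Set (Sym2 (Fin n))) = {e | o ∉ e} := coe_edgesAvoiding o
      set Supp : Finset (Sym2 (Fin n)) := Eo ∪ Q.image (fun m => s(o, p m)) with hSupp
      have hdj : Disjoint ({s(o, p m₀)} : Finset (Sym2 (Fin n))) Supp := by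
        rw [Finset.disjoint_singleton_left, hSupp, Finset.mem_union, not_or]
        constructor
        · rw [hEo, Finset.mem_filter]; exact fun h => h.2 (Sym2.mem_mk_left _ _)
        · rw [Finset.mem_image]; rintro ⟨m, hm, heq⟩
          have : m = m₀ := hp (Sym2.congr_right.1 heq)
          exact hm₀ (this ▸ hm)
      have hdet : DeterminedBy (EQ ∩ F ∩ R0) (↑Supp : Set (Sym2 (Fin n))) := by
        rw [determinedBy_iff]
        intro ω ω' h
        have hH : ω ∩ {e | o ∉ e} = ω' ∩ {e | o ∉ e} := by
          rw [← hcoe]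
          ext f
          have := Set.ext_iff.1 h f
          simp only [hSupp, Finset.coe_union, mem_inter_iff, mem_union, Finset.mem_coe] at this ⊢
          constructor
          · rintro ⟨hf, hfE⟩; exact ⟨(this.1 ⟨hf, Or.inl hfE⟩).1, hfE⟩
          · rintro ⟨hf, hfE⟩; exact ⟨(this.2 ⟨hf, Or.inl hfE⟩).1, hfE⟩
        have hQc : ∀ m ∈ Q, (s(o, p m) ∈ ω ↔ s(o, p m) ∈ ω') := by
          intro m hm
          have hmem : s(o, p m) ∈ (↑Supp : Set (Sym2 (Fin n))) := by
            rw [Finset.mem_coe, hSupp, Finset.mem_union, Finset.mem_image]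
            exact Or.inr ⟨m, hm, rfl⟩
          have := Set.ext_iff.1 h (s(o, p m))
          simp only [mem_inter_iff, hmem, and_true] at this
          exact this
        simp only [hEQ, hF, hR0, hR, hM, mem_inter_iff, mem_setOf_eq]
        rw [hH]
        constructor
        · rintro ⟨⟨h1, h2⟩, h3⟩; exact ⟨⟨fun m hm hr => (hQc m hm).not.1 (h1 m hm hr), h2⟩, h3⟩
        · rintro ⟨⟨h1, h2⟩, h3⟩; exact ⟨⟨fun m hm hr => (hQc m hm).not.2 (h1 m hm hr), h2⟩, h3⟩
      have hind : (prodBernoulli w).real (C0 ∩ (EQ ∩ F ∩ R0)) =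
          (1 - c) * (prodBernoulli w).real (EQ ∩ F ∩ R0) := by
        rw [prodBernoulli_real_inter_of_determinedBy_disjoint w hdj (determinedBy_closed (s(o, p m₀))) hdet
          MeasurableSet.of_discrete MeasurableSet.of_discrete, measureReal_closed]
      have hR0split := measureReal_inter_add_sdiff (μ := prodBernoulli w) (s := EQ ∩ F)
        (MeasurableSet.of_discrete (s := R0)) (measure_ne_top _ _)
      have hdiffR : (EQ ∩ F) \ R0 = EQ ∩ F ∩ R0ᶜ := by ext ω; simp only [mem_sdiff, mem_inter_iff, mem_compl_iff]
      rw [hdiffR] at hR0split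
      rw [hsplit, measureReal_union hdisj MeasurableSet.of_discrete, hind, hinsert, hplain, ← hR0split]
      ring
    rw [decomp l S, decomp i S]
    have h1 := ih (insert (p m₀) S)
    have h2 := ih S
    have h1c := mul_le_mul_of_nonneg_left h1 hc0
    have h2c := mul_le_mul_of_nonneg_left h2 (by linarith : (0 : ℝ) ≤ 1 - c)
    linarith

end CutObserver

open CutObserver in
/-- **CIL for every observer adjacent only to relays (unconditional).**  Let `o ∉ A` and let every positive-weight neighbour
of `o` be one of the relays `p 0, …, p (d−1) ∈ A` (`p` injective, `d ≥ 1`); the weighted graph is otherwise arbitrary.  Then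
for every level `j` there is a relay `a ∈ A` with `μ{1 ≤ N ≤ j} ≤ μ{|π(a)| ≤ j}` — the registered stub
`stub_cumulativeIsolation` (crux `NoHeavyLowerTail`, stmt-CriticalPhenomena-4575) on this class, for every `|A|`.  Witness: the
port whose cluster without the edges at `o` is most often light; proof = `cil_relayNeighbours_of_portComparison` with the port
comparison discharged by `portComparison_of_separation` (BHK two-cluster exchange ⇒ separation stability ⇒ coin integration).
[cite: VandenbergHaggstromKahn2005, Thm. 1.5 — the only probabilistic input] -/
theorem cil_relayNeighbours (w : Sym2 (Fin n) → unitInterval) (A : Finset (Fin n)) (o : Fin n) (j : ℕ) {d : ℕ}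
    (p : Fin d → Fin n) (hp : Function.Injective p) (hpA : ∀ l, p l ∈ A) (hoA : o ∉ A) (hd : 0 < d)
    (hobs : ∀ v, w s(o, v) ≠ 0 → ∃ l, v = p l) :
    ∃ a ∈ A,
      (prodBernoulli w).real {ω : BondConfig (Fin n) |
          1 ≤ (A.filter fun x => ω ∈ openConn o x).card ∧ (A.filter fun x => ω ∈ openConn o x).card ≤ j} ≤
        (prodBernoulli w).real {ω : BondConfig (Fin n) | (A.filter fun x => ω ∈ openConn a x).card ≤ j} := by
  set sH : Fin d → ℝ := fun m => (prodBernoulli w).real {ω : BondConfig (Fin n) |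
    (A.filter fun x => (openGraph (ω ∩ {e | o ∉ e})).Reachable (p m) x).card ≤ j} with hsH
  obtain ⟨i, -, hi⟩ := Finset.exists_max_image Finset.univ sH ⟨⟨0, hd⟩, Finset.mem_univ _⟩
  refine ⟨p i, hpA i, cil_relayNeighbours_of_portComparison w A o j p hp hpA hoA hobs i ?_⟩
  intro l hli
  have key := portComparison_of_separation w A o j p hp (Ne.symm hli) (hi l (Finset.mem_univ _))
    (Finset.univ.filter fun m => l < m) {p l}
  have e : ∀ x : Fin d,
      {ω : BondConfig (Fin n) | ¬ (openGraph (ω ∩ {e | o ∉ e})).Reachable (p l) (p i)} ∩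
        {ω | ∀ m, l < m → (openGraph (ω ∩ {e | o ∉ e})).Reachable (p m) (p i) → s(o, p m) ∉ ω} ∩
        {ω | (A.filter fun y => (openGraph (ω ∩ {e | o ∉ e})).Reachable (p x) y).card ≤ j} =
      {ω : BondConfig (Fin n) | ∀ m ∈ (Finset.univ.filter fun m => l < m),
          (openGraph (ω ∩ {e | o ∉ e})).Reachable (p m) (p i) → s(o, p m) ∉ ω} ∩
        {ω | ∀ v ∈ ({p l} : Finset (Fin n)), ¬ (openGraph (ω ∩ {e | o ∉ e})).Reachable v (p i)} ∩
        {ω | (A.filter fun y => (openGraph (ω ∩ {e | o ∉ e})).Reachable (p x) y).card ≤ j} := by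
    intro x
    ext ω
    simp only [Finset.mem_filter, Finset.mem_univ, true_and, Finset.mem_singleton, forall_eq, mem_inter_iff,
      mem_setOf_eq]
    tauto
  rw [e l, e i]
  exact key

end Summit.CriticalPhenomena.PercolationContinuityZ3.Theorems

end
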